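import Summits.BirchSwinnertonDyer.BirchSwinnertonDyer.Theorems.EisensteinDepletionAtTwoStarStabCoeff
import Literature.NumberTheory.ModularForms.RademacherPhiCompositionProofs
import HarnessLib

/-!
# Route `EisensteinDepletionAtTwo`, crux E1M `DepletedLambdaLawAtTwoMod` (stmt-BirchSwinnertonDyer-20341), line `star`:
# the stabilised Eisenstein period function `φ_β = stabEisensteinPeriod N β` is ADDITIVE on `Γ₀(N)` (every level, every admissible `β`)

Cell `bsd-rank2` (HOME run/shared/lean/pub/bsd-rank2/), seat `bsd-rank2-eng` GEN 10 (helper `--supports` the crux item). The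
level-15 Eisenstein period law (`Rank2.LevelFifteen.eisPeriod15SL_mul`, p570928) and the seat's per-class certificates (kit j291759:
for every habitat class of odd conductor `≤ 2000`, `φ_β/c_F ≡ L⁺ + χ(d) (mod 2)` as HOMOMORPHISMS `Γ₀(N) → ℤ/2`) both rest on the
additivity of the Eisenstein period `φ_β(γ) = ∑_{t ∣ N} c_t·Φ(γ_t)` on `Γ₀(N)`, which holds at EVERY level for every admissible `β`
because `∑_t c_t = 0` (`sum_divisors_stabCoeff_eq_zero`) kills the composition defect `−3·sign(c c′ c″)·∑ c_t` of Rademacher's `Φ`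
(each `Ψ_t = Φ − Φ(·_t)` being additive on `Γ₀(t) ⊇ Γ₀(N)`, Literature `eisensteinPsiSL_mul'`). This is the rational-weight form of
lit GEN 22's `sum_rademacherPhi_conj_mul` (integer weights), stated for the tree's `stabEisensteinPeriod`.

* **`stabEisensteinPeriod_mul`**: `φ_β(AB) = φ_β(A) + φ_β(B)` (entries read off `A, B, AB ∈ SL(2, ℤ)`) for `N ∣ c_A`, `N ∣ c_B`,
  `N ≠ 0`, `β` admissible; `stabEisensteinPeriod_one`, `stabEisensteinPeriod_inv`, `stabEisensteinPeriod_pow` (natural powers).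

THEOREMS ONLY; no `sorry`; standard axioms.
PARTITION: none — r_an ≥ 2, summit axis S0 (D-0036(1)); TWIN (D-0056): n/a. B1 honesty: Dedekind-sum bookkeeping; nothing reads an
analytic rank; no S0 motion; (★-SymbC), (★), E1M and BSD are NOT proved by this.

References: H. Rademacher, E. Grosswald, *Dedekind Sums*, Carus Monograph 16 (1972), Ch. 4 A eq. (59)–(62) [RademacherGrosswald1972];
G. Stevens, *Arithmetic on Modular Curves*, Progr. Math. 20 (1982) §2.4–2.5 [Stevens1982].
-/

set_option linter.dupNamespace false

noncomputable section

open scoped MatrixGroups ModularForm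

open CongruenceSubgroup Matrix.SpecialLinearGroup
open Literature.NumberTheory.ModularForms

namespace Summit.BirchSwinnertonDyer.BirchSwinnertonDyer.Theorems.DepletionAtTwo

/-- **`φ_β` is additive on `Γ₀(N)`** (`N ≠ 0`, `β` admissible): for `A, B ∈ SL(2, ℤ)` with `N ∣ c_A`, `N ∣ c_B`,
`φ_β(AB) = φ_β(A) + φ_β(B)` where `φ_β(M) = stabEisensteinPeriod N β M₀₀ M₀₁ M₁₀ M₁₁ = ∑_{t ∣ N} c_t Φ(M_t)`.
Proof: each `Ψ_t = Φ − Φ(·_t)` is additive on `Γ₀(t)`; the `Φ`-defects add up to `(∑ c_t)·(Φ(AB) − Φ(A) − Φ(B)) = 0`.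
[cite: RademacherGrosswald1972, Ch. 4 A, eq. (62)] [cite: Stevens1982, §2.5 (PDF p. 38)] -/
theorem stabEisensteinPeriod_mul {N : ℕ} (hN : N ≠ 0) {β : ℕ → ℕ} (hadm : IsAdmissibleStabData N β)
    {A B : SL(2, ℤ)} (hA : (N : ℤ) ∣ A 1 0) (hB : (N : ℤ) ∣ B 1 0) :
    stabEisensteinPeriod N β ((A * B) 0 0) ((A * B) 0 1) ((A * B) 1 0) ((A * B) 1 1) =
      stabEisensteinPeriod N β (A 0 0) (A 0 1) (A 1 0) (A 1 1) +
        stabEisensteinPeriod N β (B 0 0) (B 0 1) (B 1 0) (B 1 1) := by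
  have h0 : ∑ t ∈ N.divisors, stabCoeff N β t = 0 := sum_divisors_stabCoeff_eq_zero hN hadm
  have key : ∀ t ∈ N.divisors, stabCoeff N β t *
      rademacherPhi ((A * B) 0 0) (t * (A * B) 0 1) ((A * B) 1 0 / t) ((A * B) 1 1) =
        stabCoeff N β t * rademacherPhi (A 0 0) (t * A 0 1) (A 1 0 / t) (A 1 1) +
          stabCoeff N β t * rademacherPhi (B 0 0) (t * B 0 1) (B 1 0 / t) (B 1 1) +
          stabCoeff N β t * (rademacherPhiSL (A * B) - rademacherPhiSL A - rademacherPhiSL B) := by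
    intro t ht
    have htN : (t : ℤ) ∣ N := Int.natCast_dvd_natCast.mpr (Nat.dvd_of_mem_divisors ht)
    have hΨ := eisensteinPsiSL_mul' (Nat.pos_of_mem_divisors ht) (dvd_trans htN hA) (dvd_trans htN hB)
    rw [eisensteinPsiSL_apply, eisensteinPsiSL_apply, eisensteinPsiSL_apply] at hΨ
    linear_combination (-(stabCoeff N β t)) * hΨ
  rw [stabEisensteinPeriod_eq, stabEisensteinPeriod_eq, stabEisensteinPeriod_eq, Finset.sum_congr rfl key,
    Finset.sum_add_distrib, Finset.sum_add_distrib, ← Finset.sum_mul, h0, zero_mul, add_zero]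

/-- `φ_β(1) = 0`. [cite: RademacherGrosswald1972, Ch. 4 A, eq. (59)] -/
theorem stabEisensteinPeriod_one (N : ℕ) (β : ℕ → ℕ) :
    stabEisensteinPeriod N β ((1 : SL(2, ℤ)) 0 0) ((1 : SL(2, ℤ)) 0 1) ((1 : SL(2, ℤ)) 1 0) ((1 : SL(2, ℤ)) 1 1) = 0 := by
  rw [stabEisensteinPeriod_eq]
  exact Finset.sum_eq_zero fun t _ ↦ by simp [rademacherPhi_of_c_eq_zero]

/-- `φ_β(A⁻¹) = −φ_β(A)` on `Γ₀(N)`. [cite: RademacherGrosswald1972, Ch. 4 A, eq. (62)] -/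
theorem stabEisensteinPeriod_inv {N : ℕ} (hN : N ≠ 0) {β : ℕ → ℕ} (hadm : IsAdmissibleStabData N β)
    {A : SL(2, ℤ)} (hA : (N : ℤ) ∣ A 1 0) :
    stabEisensteinPeriod N β ((A⁻¹) 0 0) ((A⁻¹) 0 1) ((A⁻¹) 1 0) ((A⁻¹) 1 1) =
      -stabEisensteinPeriod N β (A 0 0) (A 0 1) (A 1 0) (A 1 1) := by
  have hAinv : (N : ℤ) ∣ (A⁻¹) 1 0 := by
    simp [Matrix.SpecialLinearGroup.coe_inv, Matrix.adjugate_fin_two]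
    exact hA
  have h := stabEisensteinPeriod_mul hN hadm hAinv hA
  rw [inv_mul_cancel, stabEisensteinPeriod_one] at h
  linarith

/-- `φ_β(Aⁿ) = n·φ_β(A)` on `Γ₀(N)` (natural powers). [cite: RademacherGrosswald1972, Ch. 4 A, eq. (62)] -/
theorem stabEisensteinPeriod_pow {N : ℕ} (hN : N ≠ 0) {β : ℕ → ℕ} (hadm : IsAdmissibleStabData N β)
    {A : SL(2, ℤ)} (hA : (N : ℤ) ∣ A 1 0) (n : ℕ) :
    stabEisensteinPeriod N β ((A ^ n) 0 0) ((A ^ n) 0 1) ((A ^ n) 1 0) ((A ^ n) 1 1) =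
      n * stabEisensteinPeriod N β (A 0 0) (A 0 1) (A 1 0) (A 1 1) := by
  have hpow : ∀ k : ℕ, (N : ℤ) ∣ (A ^ k) 1 0 := by
    intro k
    induction k with
    | zero => simp
    | succ k ih =>
      rw [pow_succ, Matrix.SpecialLinearGroup.coe_mul, Matrix.mul_apply, Fin.sum_univ_two]
      exact dvd_add (dvd_mul_of_dvd_left ih _) (dvd_mul_of_dvd_right hA _)
  induction n with
  | zero => rw [pow_zero, stabEisensteinPeriod_one]; simp
  | succ n ih =>
    rw [pow_succ, stabEisensteinPeriod_mul hN hadm (hpow n) hA, ih]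
    push_cast
    ring

end Summit.BirchSwinnertonDyer.BirchSwinnertonDyer.Theorems.DepletionAtTwo

end
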